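import Summits.BirchSwinnertonDyer.BirchSwinnertonDyer.Theorems.Rank2Observatory2DescClCurveCertDSound
import HarnessLib

/-!
# BirchSwinnertonDyer — rank ≥ 2 observatory: KERNEL-2DESC-CL ΩD — the per-curve certificate over a dyadic-root-view field record, part 5/7: valuations at the four auxiliary primes

HONEST FRAMING: per-curve certified theorems and census instruments; no claim on BSD in rank ≥ 2.

Part 5 of 7.  `log ord` of a checked `ω`-family element at the four auxiliary primes `W₁₁r, W₁₂r` (above `q₁`)
and `W₂₁r, W₂₂r` (above `q₂`): the element `q₁` (kind `1`) has `(−1, −1, 0, 0)`, the element `q₂` (kind `4`) has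
`(0, 0, −1, −1)`, a generic element is read on `X = M x` through `omega_dispatch` (`q₁, q₂ ∤ M`) with the
certified `ordCheck` exponents and the `invCert` exclusions from `W₁₂r`, `W₂₂r`; the height-one prime of a tagged
support code (`codePrimeD`: tag `0` an `α`-registry code, tag `i` the dyadic prime `Pᵢ`); the square rescaling
`M · M^n = (r₁^{n+1})²`.  Text = E2Q2 part 6 (`…2DescClCurveCertE2Q2Logs`) over the `ω`-presentation.  New
declarations only; sorry-free; axioms `propext`, `Classical.choice`, `Quot.sound`.
[cite: Marcus2018, Ch. 3, Thm. 22] [cite: Cohen1993, §4.8.2] [cite: Cassels1991LecturesEllipticCurves, §15]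
-/

set_option linter.dupNamespace false

noncomputable section

open scoped Classical NumberField nonZeroDivisors

open Literature.NumberTheory.NumberFields Polynomial Module NumberField IsDedekindDomain Ideal

namespace Summit.BirchSwinnertonDyer.BirchSwinnertonDyer.Rank2Observatory.TwoDescCl

open TwoDescCubic ClFieldCertQ2 TwoDescPadic

section Sound

variable {K : Type*} [Field K] [NumberField K] {θ : K} {F : ClFieldCertDc} {cc : ClCurveCertD} {f : FamEntryD}

/-! ### The elements `q₁`, `q₂` of the family -/

/-- The element of kind `1` is literally `q₁`. -/
theorem eltD_eq_q₁ (hθ : aeval θ (MonicCubic.poly F.fd.base.a F.fd.base.b F.fd.base.c) = 0)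
    (hD : F.fd.checkCoreD = true) (hK : F.checkConst = true) (h : famCheckD F cc f = true) (h1 : f.kind = 1) :
    eltD F hθ hD f.W = ((F.fd.base.q₁ : ℕ) : 𝓞 K) := by
  have hk := kind_of_famCheckD h
  unfold famKindCheckD at hk
  rw [if_pos h1, decide_eq_true_eq] at hk
  have hX : lin hθ f.X.1 f.X.2.1 f.X.2.2 = (F.M : 𝓞 K) * ((F.fd.base.q₁ : ℕ) : 𝓞 K) := by
    rw [hk]
    simp only
    rw [lin_const hθ]
    push_cast
    ring
  exact mul_left_cancel₀ (M_ne_zero_OD hK) ((M_mul_eltD hθ hD (ov_of_famCheckD h)).trans hX)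

/-- The element of kind `4` is literally `q₂`. -/
theorem eltD_eq_q₂ (hθ : aeval θ (MonicCubic.poly F.fd.base.a F.fd.base.b F.fd.base.c) = 0)
    (hD : F.fd.checkCoreD = true) (hK : F.checkConst = true) (h : famCheckD F cc f = true) (h4 : f.kind = 4) :
    eltD F hθ hD f.W = ((F.fd.base.q₂ : ℕ) : 𝓞 K) := by
  have hk := kind_of_famCheckD h
  unfold famKindCheckD at hk
  have h1 : f.kind ≠ 1 := by omega
  rw [if_neg h1, if_pos h4, decide_eq_true_eq] at hk
  have hX : lin hθ f.X.1 f.X.2.1 f.X.2.2 = (F.M : 𝓞 K) * ((F.fd.base.q₂ : ℕ) : 𝓞 K) := by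
    rw [hk]
    simp only
    rw [lin_const hθ]
    push_cast
    ring
  exact mul_left_cancel₀ (M_ne_zero_OD hK) ((M_mul_eltD hθ hD (ov_of_famCheckD h)).trans hX)

/-- The generic-kind clauses: `X ∉ W₁₂`, `X ∉ W₂₂`, `ord_{q₁}`, `ord_{q₂}` of `|N(X)|`. -/
theorem generic_of_famCheckD (h : famCheckD F cc f = true) (h1 : f.kind ≠ 1) (h4 : f.kind ≠ 4) :
    invCert F.fd.base.a F.fd.base.b F.fd.base.c F.fd.base.w₁₂ f.X f.inv12 = true ∧
      invCert F.fd.base.a F.fd.base.b F.fd.base.c F.fd.base.w₂₂ f.X f.inv22 = true ∧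
      ordCheck F.fd.base.q₁ (normFormZ F.fd.base.a F.fd.base.b F.fd.base.c f.X.1 f.X.2.1 f.X.2.2).natAbs
        (f.e % 64) = true ∧
      ordCheck F.fd.base.q₂ (normFormZ F.fd.base.a F.fd.base.b F.fd.base.c f.X.1 f.X.2.1 f.X.2.2).natAbs
        (f.e / 64) = true := by
  have hk := kind_of_famCheckD h
  unfold famKindCheckD at hk
  rw [if_neg h1, if_neg h4] at hk
  simp only [Bool.and_eq_true] at hk
  exact ⟨hk.1.1.1, hk.1.1.2, hk.1.2, hk.2⟩

/-! ### `log ord` at `W₁₁r, W₁₂r, W₂₁r, W₂₂r` -/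

/-- **`log ord_{W₁₁}(x)`** of a `ω`-family element (read on `X`; `q₁ ∤ m₁`). [cite: Marcus2018, Ch. 3, Thm. 22] -/
theorem log_W₁₁r_of_famCheckD (hθ : aeval θ (MonicCubic.poly F.fd.base.a F.fd.base.b F.fd.base.c) = 0)
    (h3 : finrank ℚ K = 3) (hD : F.fd.checkCoreD = true) (hK : F.checkConst = true)
    (hpr : F.fd.base.primeList.Forall Nat.Prime) (h : famCheckD F cc f = true) :
    WithZero.log ((F.fd.base.W₁₁r hθ h3 (F.fd.checkReg_of_coreD hD) (hpr)).valuation K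
      ((eltD F hθ hD f.W : 𝓞 K) : K)) = famL₁₁D f := by
  have hR := F.fd.checkReg_of_coreD hD
  unfold famL₁₁D
  by_cases h1 : f.kind = 1
  · rw [if_pos h1, eltD_eq_q₁ hθ hD hK h h1]
    exact (log_q₁r hθ h3 hR hpr).1
  rw [if_neg h1]
  by_cases h4 : f.kind = 4
  · rw [if_pos h4, eltD_eq_q₂ hθ hD hK h h4,
      valuation_eq_one_of_not_mem _ (q₂_not_mem_of_q₁_mem_reg hR hpr _ (q₁_mem_W₁₁r hθ h3 hR hpr)),
      WithZero.log_one]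
  rw [if_neg h4]
  obtain ⟨hinv12, -, hord₁, -⟩ := generic_of_famCheckD h h1 h4
  have hdisp := (omega_dispatch hθ (F.fd.d_pos hD) (F.fd.aeval_omega hθ hD)
      (ov_of_famCheckD h) (F.fd.base.W₁₁r hθ h3 hR hpr) (q₁_mem_W₁₁r hθ h3 hR hpr) (F.coprime_q₁ hK)).2
  unfold eltD
  rw [hdisp]
  exact log_W₁₁r_of_not_mem hθ h3 hR hpr (lin_not_mem_of_invCert hθ _ (W₁₂r_asIdeal hθ h3 hR hpr) hinv12)
    hord₁

/-- **`log ord_{W₁₂}(x)`** of a `ω`-family element. [cite: Marcus2018, Ch. 3, Thm. 22] -/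
theorem log_W₁₂r_of_famCheckD (hθ : aeval θ (MonicCubic.poly F.fd.base.a F.fd.base.b F.fd.base.c) = 0)
    (h3 : finrank ℚ K = 3) (hD : F.fd.checkCoreD = true) (hK : F.checkConst = true)
    (hpr : F.fd.base.primeList.Forall Nat.Prime) (h : famCheckD F cc f = true) :
    WithZero.log ((F.fd.base.W₁₂r hθ h3 (F.fd.checkReg_of_coreD hD) (hpr)).valuation K
      ((eltD F hθ hD f.W : 𝓞 K) : K)) = famL₁₂D f := by
  have hR := F.fd.checkReg_of_coreD hD
  unfold famL₁₂D
  by_cases h1 : f.kind = 1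
  · rw [if_pos h1, eltD_eq_q₁ hθ hD hK h h1]
    exact (log_q₁r hθ h3 hR hpr).2
  rw [if_neg h1]
  have hval : (F.fd.base.W₁₂r hθ h3 hR hpr).valuation K ((eltD F hθ hD f.W : 𝓞 K) : K) = 1 := by
    by_cases h4 : f.kind = 4
    · rw [eltD_eq_q₂ hθ hD hK h h4]
      exact valuation_eq_one_of_not_mem _ (q₂_not_mem_of_q₁_mem_reg hR hpr _ (q₁_mem_W₁₂r hθ h3 hR hpr))
    obtain ⟨hinv12, -, -, -⟩ := generic_of_famCheckD h h1 h4
    have hdisp := (omega_dispatch hθ (F.fd.d_pos hD) (F.fd.aeval_omega hθ hD)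
      (ov_of_famCheckD h) (F.fd.base.W₁₂r hθ h3 hR hpr) (q₁_mem_W₁₂r hθ h3 hR hpr) (F.coprime_q₁ hK)).2
    unfold eltD
    rw [hdisp]
    exact valuation_eq_one_of_invCert hθ _ (W₁₂r_asIdeal hθ h3 hR hpr) hinv12
  rw [hval, WithZero.log_one]

/-- **`log ord_{W₂₁}(x)`** of a `ω`-family element (read on `X`; `q₂ ∤ m₁`). [cite: Marcus2018, Ch. 3, Thm. 22] -/
theorem log_W₂₁r_of_famCheckD (hθ : aeval θ (MonicCubic.poly F.fd.base.a F.fd.base.b F.fd.base.c) = 0)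
    (h3 : finrank ℚ K = 3) (hD : F.fd.checkCoreD = true) (hK : F.checkConst = true)
    (hpr : F.fd.base.primeList.Forall Nat.Prime) (h : famCheckD F cc f = true) :
    WithZero.log ((F.fd.base.W₂₁r hθ h3 (F.fd.checkReg_of_coreD hD) (hpr)).valuation K
      ((eltD F hθ hD f.W : 𝓞 K) : K)) = famL₂₁D f := by
  have hR := F.fd.checkReg_of_coreD hD
  unfold famL₂₁D
  by_cases h1 : f.kind = 1
  · rw [if_pos h1, eltD_eq_q₁ hθ hD hK h h1,
      valuation_eq_one_of_not_mem _ (q₁_not_mem_of_q₂_mem_reg hR hpr _ (q₂_mem_W₂₁r hθ h3 hR hpr)),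
      WithZero.log_one]
  rw [if_neg h1]
  by_cases h4 : f.kind = 4
  · rw [if_pos h4, eltD_eq_q₂ hθ hD hK h h4]
    exact (log_q₂r hθ h3 hR hpr).1
  rw [if_neg h4]
  obtain ⟨-, hinv22, -, hord₂⟩ := generic_of_famCheckD h h1 h4
  have hdisp := (omega_dispatch hθ (F.fd.d_pos hD) (F.fd.aeval_omega hθ hD)
      (ov_of_famCheckD h) (F.fd.base.W₂₁r hθ h3 hR hpr) (q₂_mem_W₂₁r hθ h3 hR hpr) (F.coprime_q₂ hK)).2
  unfold eltD
  rw [hdisp]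
  exact log_W₂₁r_of_not_mem hθ h3 hR hpr (lin_not_mem_of_invCert hθ _ (W₂₂r_asIdeal hθ h3 hR hpr) hinv22)
    hord₂

/-- **`log ord_{W₂₂}(x)`** of a `ω`-family element. [cite: Marcus2018, Ch. 3, Thm. 22] -/
theorem log_W₂₂r_of_famCheckD (hθ : aeval θ (MonicCubic.poly F.fd.base.a F.fd.base.b F.fd.base.c) = 0)
    (h3 : finrank ℚ K = 3) (hD : F.fd.checkCoreD = true) (hK : F.checkConst = true)
    (hpr : F.fd.base.primeList.Forall Nat.Prime) (h : famCheckD F cc f = true) :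
    WithZero.log ((F.fd.base.W₂₂r hθ h3 (F.fd.checkReg_of_coreD hD) (hpr)).valuation K
      ((eltD F hθ hD f.W : 𝓞 K) : K)) = famL₂₂D f := by
  have hR := F.fd.checkReg_of_coreD hD
  unfold famL₂₂D
  by_cases h4 : f.kind = 4
  · rw [if_pos h4, eltD_eq_q₂ hθ hD hK h h4]
    exact (log_q₂r hθ h3 hR hpr).2
  rw [if_neg h4]
  have hval : (F.fd.base.W₂₂r hθ h3 hR hpr).valuation K ((eltD F hθ hD f.W : 𝓞 K) : K) = 1 := by
    by_cases h1 : f.kind = 1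
    · rw [eltD_eq_q₁ hθ hD hK h h1]
      exact valuation_eq_one_of_not_mem _ (q₁_not_mem_of_q₂_mem_reg hR hpr _ (q₂_mem_W₂₂r hθ h3 hR hpr))
    obtain ⟨-, hinv22, -, -⟩ := generic_of_famCheckD h h1 h4
    have hdisp := (omega_dispatch hθ (F.fd.d_pos hD) (F.fd.aeval_omega hθ hD)
      (ov_of_famCheckD h) (F.fd.base.W₂₂r hθ h3 hR hpr) (q₂_mem_W₂₂r hθ h3 hR hpr) (F.coprime_q₂ hK)).2
    unfold eltD
    rw [hdisp]
    exact valuation_eq_one_of_invCert hθ _ (W₂₂r_asIdeal hθ h3 hR hpr) hinv22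
  rw [hval, WithZero.log_one]

/-! ### The code primes of the support -/

variable (F) in
/-- The height-one prime of a tagged support code (tag `0` = the `α`-registry code, tag `i` = the dyadic prime `Pᵢ`). -/
def codePrimeD (hθ : aeval θ (MonicCubic.poly F.fd.base.a F.fd.base.b F.fd.base.c) = 0) (h3 : finrank ℚ K = 3)
    (hD : F.fd.checkCoreD = true) (hpr : F.fd.base.primeList.Forall Nat.Prime)
    (R₁ : RootedPrime θ 2 F.fd.P₁.ra F.fd.N) (R₂ : RootedPrime θ 2 F.fd.P₂.ra F.fd.N)
    (R₃ : RootedPrime θ 2 F.fd.P₃.ra F.fd.N) (bc : (ℕ × PCode) × FamEntryD) : HeightOneSpectrum (𝓞 K) :=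
  if bc.1.1 = 0 then codePrimeR hθ h3 (F.fd.checkReg_of_coreD hD) hpr bc.1.2 else dyPrime R₁ R₂ R₃ bc.1.1

/-! ### The square rescaling of the kill relation -/

omit [NumberField K] in
/-- `M · M^{n} = (r₁^{n+1})²` in `K`. [folklore] -/
theorem M_mul_pow_eq_sq (F : ClFieldCertDc) (n : ℕ) :
    (F.M : K) * (F.M : K) ^ n = ((F.r₁ : K) ^ (n + 1)) ^ 2 := by
  rw [← pow_succ', ClFieldCertDc.M, Nat.cast_pow, ← pow_mul, ← pow_mul, Nat.mul_comm]

end Sound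

end Summit.BirchSwinnertonDyer.BirchSwinnertonDyer.Rank2Observatory.TwoDescCl
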